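import Literature.Claims.NS.ClayVariants
import Mathlib.Analysis.SpecialFunctions.Trigonometric.Basic
import Mathlib.Analysis.SpecialFunctions.Pow.Real
import HarnessLib

/-!
# Claim skeleton (QUICK, T3 tranche tail; SOL-type, statement grain): Jha (2018), «The complete
# Solution for existence and smoothness of Navier-Stokes equation»

Cell `ns-claims` (D-0090 NS-CLAIMS SWEEP), claim C65, typist `ns-claims-typist-9` (g2). UNREFEREED CLAIM
under adjudication — NOTHING in this file asserts a step: every `Step…` declaration is a `Prop`; the
`theorem`s are the composition of the paper's own chain, the Clay link and one delta fact.

Version of record: Mihir Kumar Jha, OSF Preprints (INA-Rxiv) gmh4n, 2018-09-03,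
doi:10.31227/osf.io/gmh4n; 7 image-only PDF pages (PDF page = page). Texts: ns-claims-lit-3 g2's hand
transcription `pub/ns-claims/sources/Jha2018/osf-gmh4n/TRANSCRIPT.md` (verified against
`renders/p001–p007.png`). Bib key `Jha2018`.

## Claimed statement (as printed)

Conclusion p.5–6: «It can be clearly seen from equation (15) and (16) (when initial velocity is equal
to zero) and from equation (20) and (21) (when initial velocity is not equal to zero) that there always
exist a smooth solutions at a given time t. In other words, In three space dimensions and time, given an
initial velocity field, there always exists a vector velocity and a scalar pressure field, which are
both smooth and globally defined, thus completing the solution.» Typed: `ClaimedTheorem :=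
ClayVariants.clayR3.Regularity` (the second sentence is (A)'s conclusion; (A) is cited, not restated).

## The printed device (SOL-type) and the Clay delta

The paper replaces (1) `ρ dV̄/dt = −∇P + ρḡ + μ∇²V̄` (p.1; NO continuity equation — «I intend to define
an exact and smooth solution without using the continuity equation», p.1 — Δ2; gravity `ρḡ` kept — Δ3)
by Newton's law for a fluid element (3)–(4) and an «energy» step (5)–(6) p.2 producing the scalar law
(11) p.3 `V = √((2/ρ)F² + (V⁰)²)` between the SPEED `V(t)` and the magnitude `F(t)` of the net force;
then Case 1 (`V⁰ = 0`): (14) `F = e^{t/√(2ρ)}`, (15) `V = √(2/ρ) e^{t/√(2ρ)}`, (16)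
`∇P = ρḡ + μ∇²V̄ − e^{t/√(2ρ)}`; Case 2 (`V⁰ ≠ 0`): (19) `F = (V⁰ρ/2) tan(t/(√2 ρ^{3/2}))`, (20)
`V = V⁰ sec(t/(√2 ρ^{3/2}))`, (21) `∇P = ρḡ + μ∇²V̄ − (V⁰ρ/2) tan(t/(√2 ρ^{3/2}))`; after each case:
«at any particular time, there always exist a defined value of velocity and pressure gradient thus
completing the solution» (p.4, p.5). The «solution» is an `x`-independent scalar speed and a formula for
`∇P` containing the undetermined `μ∇²V̄` (Δ5/Δ6); the datum enters only through the number `V⁰` (Δ4).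

## Steps (print order = dependency order)

* **Step 1 = `Step1_EnergyLaw`** — (4)–(7), (11) p.2–3: «dE = F.ds … (5) dE/(dx dy dz) = ρV dV. The term
  on the L.H.S of equation (5) represents the value of force … (6) df_x = ρV dV. Integrating both sides,
  with force ranging from 0 to (f_x)² … (7) (f_x)² = (ρ/2)[u² − (V⁰_x)²] … (11) V = √((2/ρ)F² + (V⁰)²)»:
  for every motion of a unit fluid element of density `ρ` obeying Newton's law (4) `ρ dV/dt = F`, the
  speed and the force obey (11) at every time. FIRST LOAD-BEARING STEP (everything downstream is (11)
  substituted into (1)). Scalar grain.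
* Step 2 = `Step2_Case1` — Case 1 p.3–4, (12)–(15): «When initial velocity (V⁰) is equal to zero …
  (15) V = √(2/ρ) e^{t/√(2ρ)}» — the displayed Case-1 speed takes the Case-1 initial value `V(0) = V⁰ = 0`
  ((14) integrates `∫₀^F dF/F`).
* Step 3 = `Step3_Case2_defined` — Case 2 p.4–5, (20) `V = V⁰ sec(t/(√2 ρ^{3/2}))` with «Again, It can be
  clearly seen that, at any particular time, there always exist a defined value of velocity»: the secant
  is defined (its cosine non-zero) at every time `t ≥ 0`.
* Step 4 = `Step4_InOtherWords` — Conclusion p.5–6 «In other words, …»: the passage from the two Case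
  formulas to the (A)-sentence, typed as the implication it asserts (no field `(u, p)` solving (1)–(3) is
  ever written down: Δ2/Δ5).

## COMPOSITION — `claim_of_steps : Step1 → Step2 → Step3 → Step4 → ClaimedTheorem` (PROVED, modus ponens)

## Delta fact (PROVED): `delta5_uniformField` — an `x`-independent non-zero velocity field on `ℝ³` has
## unbounded energy, so it is not a Clay (A) solution ((7) fails).

WHAT THIS IS NOT: not a claim about NS regularity or blow-up; not a claim about any author beyond the
typed locator.
-/

noncomputable section

open Set MeasureTheory
open scoped ENNReal

namespace Literature.Claims.NS.Jha2018

open Literature.Analysis.FluidPDE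

/-! ## §A. The printed formulas -/

/-- Physical space `ℝ³`. [cite: Jha2018, (1) p.1] -/
abbrev E3 : Type := EuclideanSpace ℝ (Fin 3)

/-- (15) p.4, Case 1 (`V⁰ = 0`): `V(t) = √(2/ρ) e^{t/√(2ρ)}`. [cite: Jha2018, (15) p.4] -/
def speedCase1 (ρ t : ℝ) : ℝ :=
  Real.sqrt (2 / ρ) * Real.exp (t / Real.sqrt (2 * ρ))

/-- The argument of the secant/tangent in (19)–(21) p.5: `t/(√2 ρ^{3/2})`. [cite: Jha2018, (19)–(20) p.5] -/
def phase (ρ t : ℝ) : ℝ :=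
  t / (Real.sqrt 2 * ρ ^ ((3 : ℝ) / 2))

/-- (20) p.5, Case 2 (`V⁰ ≠ 0`): `V(t) = V⁰ sec(t/(√2 ρ^{3/2}))` (`sec = 1/cos`).
[cite: Jha2018, (20) p.5] -/
def speedCase2 (ρ V0 t : ℝ) : ℝ :=
  V0 / Real.cos (phase ρ t)

/-! ## §B. The claimed statement and the Clay link -/

/-- **CLAIMED THEOREM** — Conclusion p.5–6: «In three space dimensions and time, given an initial velocity
field, there always exists a vector velocity and a scalar pressure field, which are both smooth and
globally defined» = Fefferman's (A), cited through `ClayVariants.clayR3.Regularity`.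
[cite: Jha2018, Conclusion p.5–6] -/
def ClaimedTheorem : Prop :=
  ClayVariants.clayR3.Regularity

/-- The claim is (A) (definitional). [cite: Jha2018, Conclusion p.5–6] -/
theorem clay_of_claimed (h : ClaimedTheorem) : ClayVariants.clayR3.Regularity := h

/-- … and conversely. [cite: Jha2018, Conclusion p.5–6] -/
theorem claimedTheorem_iff : ClaimedTheorem ↔ ClayVariants.clayR3.Regularity := Iff.rfl

/-! ## §C. The steps -/

/-- **Step 1 — FIRST LOAD-BEARING STEP** — the «energy» law (4)–(7)/(11) p.2–3: «(4) F = (ρ dx.dy.dz)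
dV/dt … dE = F.ds … (5) dE/(dx.dy.dz) = ρ.V dV. The term on the L.H.S of equation (5) represents the
value of force … (6) df_x = ρ.V dV. Integrating both sides, with force ranging from 0 to (f_x)² with
initial and final velocities being u, V⁰_x … (7) (f_x)² = (ρ/2)[u² − (V⁰_x)²] … (11) V = √((2/ρ)F² +
(V⁰)²)»: for every motion `t ↦ V(t)` of a unit fluid element of density `ρ > 0` driven by the net force
`t ↦ F(t)` according to (4), `ρ dV/dt = F`, the relation (11) holds at every time `t ≥ 0`.
[cite: Jha2018, (4)–(7) p.2, (11) p.3] -/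
def Step1_EnergyLaw : Prop :=
  ∀ ρ : ℝ, 0 < ρ → ∀ V F : ℝ → ℝ, (∀ t : ℝ, HasDerivAt V (F t / ρ) t) →
    ∀ t : ℝ, 0 ≤ t → V t = Real.sqrt (2 / ρ * F t ^ 2 + V 0 ^ 2)

/-- **Step 2** — Case 1 p.3–4: «When initial velocity (V⁰) is equal to zero … (12) V = √(2/ρ)F … (14)
∫₀^F dF/F = ∫₀^t dt/√(2ρ) ⟹ F = e^{t/√(2ρ)} … (15) V = √(2/ρ) e^{t/√(2ρ)}»: the displayed Case-1 speed
has the Case-1 initial value, `V(0) = V⁰ = 0`. [cite: Jha2018, (12)–(15) p.3–4] -/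
def Step2_Case1 : Prop :=
  ∀ ρ : ℝ, 0 < ρ → speedCase1 ρ 0 = 0

/-- **Step 3** — Case 2 p.4–5, (20) `V = V⁰ sec(t/(√2 ρ^{3/2}))` and «Again, It can be clearly seen that,
at any particular time, there always exist a defined value of velocity and pressure gradient»: for
`ρ > 0`, `V⁰ ≠ 0` the secant in (20) is defined — its cosine does not vanish — at every `t ≥ 0`.
[cite: Jha2018, (20) p.5 and the sentence after (21)] -/
def Step3_Case2_defined : Prop :=
  ∀ ρ : ℝ, 0 < ρ → ∀ V0 : ℝ, V0 ≠ 0 → ∀ t : ℝ, 0 ≤ t → Real.cos (phase ρ t) ≠ 0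

/-- **Step 4 — the Conclusion's «In other words»** (p.5–6): from «(15) and (16) … (20) and (21) … there
always exist a smooth solutions at a given time t» to the (A)-sentence. Typed as the asserted
implication (no velocity FIELD and pressure solving (1)–(3) are written down; Δ2: no continuity
equation, Δ5: `x`-independent scalar speed, Δ3: gravity kept). [cite: Jha2018, Conclusion p.5–6] -/
def Step4_InOtherWords : Prop :=
  (Step1_EnergyLaw ∧ Step2_Case1 ∧ Step3_Case2_defined) → ClaimedTheorem

/-! ## §D. Composition and the delta fact -/

/-- **COMPOSITION** — the printed chain: energy law (Step 1) → Case formulas (Steps 2–3) → «In other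
words» (Step 4) → (A). PROVED (modus ponens). [cite: Jha2018, Conclusion p.5–6] -/
theorem claim_of_steps (h1 : Step1_EnergyLaw) (h2 : Step2_Case1) (h3 : Step3_Case2_defined)
    (h4 : Step4_InOtherWords) : ClaimedTheorem :=
  h4 ⟨h1, h2, h3⟩

/-- **Δ5 fact**: a spatially uniform non-zero velocity field on `ℝ³` — the only kind of «velocity» the
displays (15)/(20) describe — violates Fefferman's bounded-energy condition (7) (`HasBoundedEnergy`),
so it is never a Clay (A) solution. PROVED (`∫⁻ ‖c‖² = ∞` on `ℝ³`). [cite: Jha2018, (15) p.4, (20) p.5] -/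
theorem delta5_uniformField (c : E3) (hc : c ≠ 0) : ¬ HasBoundedEnergy (fun (_ : ℝ) (_ : E3) => c) := by
  rintro ⟨C, hC, h⟩
  have h0 := h 0 le_rfl
  have hvol : (volume : Measure E3) univ = ⊤ := by simp
  have hpos : (0 : ℝ≥0∞) < ‖c‖ₑ ^ 2 := by
    have : (0 : ℝ≥0∞) < ‖c‖ₑ := by simpa using hc
    positivity
  have hint : ∫⁻ _ : E3, ‖c‖ₑ ^ 2 = ⊤ := by
    rw [lintegral_const, hvol, ENNReal.mul_top hpos.ne']
  simp only at h0
  rw [hint] at h0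
  exact absurd (le_antisymm le_top h0 ▸ hC) (lt_irrefl ⊤)

end Literature.Claims.NS.Jha2018

end
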